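import Summits.AtomisticToContinuum.FouriersLaw.Theses.OddSectorIrreversibility
import Literature.Barriers.AtomisticToContinuum.MazurBoundBallisticOpenChain
import Literature.Barriers.AtomisticToContinuum.SpectralGapClosing

/-!
# First-integral rigidity of the closed pinned chain (helper I towards stub `stub_positiveConductance`,
# line `two-scale-gluing-log-rigidity`, crux stmt-AtomisticToContinuum-9141)

Crux `OddSectorIrreversibility.BoundedResponseConverges` (stmt-AtomisticToContinuum-9141), line
`two-scale-gluing-log-rigidity`, registered stub `stub_positiveConductance` (P) = route item
`FeketeSeriesLaw.PositiveConductance` (stmt-AtomisticToContinuum-11750): `D_N > 0` for `N ≥ 2`.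
(P) = (LR) a fixed-`N` linear-response identity (the UNPROVED item `OddSectorIrreversibility.CorrectorTheory`,
not attempted) + (ND) NON-DEGENERACY `¬(∂_{p_0}u ≡ 0 ∧ ∂_{p_{N-1}}u ≡ 0)` of the Kubo corrector. This file
proves the mechanism behind (ND), a rigidity lemma for FIRST INTEGRALS OF THE ISOLATED CHAIN:

* `poisson_hamiltonian_rigidity` — for `β ≥ 0` (so `V'' = 1 + 3βr² > 0`), every `N` and every
  `w ∈ C²` with `{H, w} ≡ 0` and `∂_{p_0} w ≡ 0`, ALL coordinate derivatives of `w` vanish; proof by the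
  Jacobi identity (`poisson_jacobi`, `PhaseSpacePoisson.lean`) with the coordinate functions, two
  recursions sweeping the chain from the left contact:
  (B) `∂_{p_k} w ≡ 0 ⇒ ∂_{q_k} w = -{w, {H, q_k}} ≡ 0`,
  (A) `∂_{q_k} w ≡ 0, ∂_{p_j} w ≡ 0 (j ≤ k) ⇒ V''(q_{k+1} - q_k)·∂_{p_{k+1}} w = {w, {H, p_k}} ≡ 0`;
* `poisson_hamiltonian_rigidity_const` / `firstIntegral_rigidity` (registered form) — hence such a
  `w` is constant (no `C²` conserved quantity of the closed chain is blind to an end momentum).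
Helper II (`…StubPositiveConductanceAux2.lean`) applies this to `w = u + Σ_k k·e_k` to get (ND).
Sources: folklore; the non-coboundary argument of the refuter write-up on stmt-11750 (EVIDENCE.md v2 §2).
-/

noncomputable section

open Finset
open scoped BigOperators ContDiff
namespace Summit.AtomisticToContinuum.FouriersLaw.Cruxes.BoundedResponseConverges.TwoScaleGluingLogRigidity.Stubs

open Literature.MathematicalPhysics.KineticTheory.HeatConduction
open Literature.MathematicalPhysics.KineticTheory.HeatConduction.OscillatorChain
open Literature.Barriers.AtomisticToContinuum
open Literature.Barriers.AtomisticToContinuum.OpenChain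

variable {N : ℕ}

/-! ### Coordinate functions and their brackets -/
/-- `∂_{p_i} p_k = [i = k]`. [folklore] -/
theorem partialP_momentum (k i : Fin N) (z : PhaseSpace N) :
    partialP i (fun z : PhaseSpace N => z.2 k) z = if i = k then 1 else 0 := by
  unfold partialP
  by_cases h : i = k
  · subst h
    simp
  · have h' : k ≠ i := Ne.symm h
    simp [Function.update_of_ne h', h]

/-- `∂_{q_i} p_k = 0`. [folklore] -/
theorem partialQ_momentum (k i : Fin N) (z : PhaseSpace N) :
    partialQ i (fun z : PhaseSpace N => z.2 k) z = 0 := by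
  unfold partialQ
  simp

/-- `∂_{q_i} q_k = [i = k]`. [folklore] -/
theorem partialQ_position (k i : Fin N) (z : PhaseSpace N) :
    partialQ i (fun z : PhaseSpace N => z.1 k) z = if i = k then 1 else 0 := by
  unfold partialQ
  by_cases h : i = k
  · subst h
    simp
  · have h' : k ≠ i := Ne.symm h
    simp [Function.update_of_ne h', h]

/-- `∂_{p_i} q_k = 0`. [folklore] -/
theorem partialP_position (k i : Fin N) (z : PhaseSpace N) :
    partialP i (fun z : PhaseSpace N => z.1 k) z = 0 := by
  unfold partialP
  simp

/-- A function of the positions only has vanishing momentum derivatives. [folklore] -/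
theorem partialP_of_fst (g : (Fin N → ℝ) → ℝ) (i : Fin N) (z : PhaseSpace N) :
    partialP i (fun z : PhaseSpace N => g z.1) z = 0 := by
  unfold partialP
  simp

/-- `{f, p_k} = -∂_{q_k} f`. [folklore] -/
theorem poisson_momentum_right (f : PhaseSpace N → ℝ) (k : Fin N) (z : PhaseSpace N) :
    poisson f (fun z : PhaseSpace N => z.2 k) z = -partialQ k f z := by
  unfold poisson
  simp only [partialP_momentum, partialQ_momentum, mul_zero, zero_sub, mul_ite, mul_one]
  rw [Finset.sum_neg_distrib, Finset.sum_ite_eq' Finset.univ k]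
  simp

/-- `{f, q_k} = ∂_{p_k} f`. [folklore] -/
theorem poisson_position_right (f : PhaseSpace N → ℝ) (k : Fin N) (z : PhaseSpace N) :
    poisson f (fun z : PhaseSpace N => z.1 k) z = partialP k f z := by
  unfold poisson
  simp only [partialP_position, partialQ_position, mul_zero, sub_zero, mul_ite, mul_one]
  rw [Finset.sum_ite_eq' Finset.univ k]
  simp

/-- The coordinate function `p_k` is smooth. [folklore] -/
theorem contDiff_momentum (k : Fin N) {n : WithTop ℕ∞} :
    ContDiff ℝ n (fun z : PhaseSpace N => z.2 k) :=
  (contDiff_apply ℝ ℝ k).comp contDiff_snd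

/-- The coordinate function `q_k` is smooth. [folklore] -/
theorem contDiff_position (k : Fin N) {n : WithTop ℕ∞} :
    ContDiff ℝ n (fun z : PhaseSpace N => z.1 k) :=
  (contDiff_apply ℝ ℝ k).comp contDiff_fst

/-- If a function vanishes identically, so does every bracket with it. [folklore] -/
theorem poisson_eq_zero_of_right_eq_zero (f : PhaseSpace N → ℝ) {g : PhaseSpace N → ℝ}
    (hg : ∀ z, g z = 0) (z : PhaseSpace N) : poisson f g z = 0 := by
  have : g = fun _ => (0 : ℝ) := funext hg
  rw [this]
  exact poisson_const_right f 0 z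

/-! ### The two Jacobi recursions for a first integral of the closed chain -/

section Rigidity

variable {β : ℝ}

/-- **Recursion B**: for `w ∈ C²` with `{H, w} ≡ 0`, `∂_{p_k} w ≡ 0 ⇒ ∂_{q_k} w ≡ 0`
(Jacobi with the coordinate `q_k`: `{w, {H, q_k}} = {w, p_k} = -∂_{q_k} w`). [folklore] -/
theorem partialQ_eq_zero_of_partialP_eq_zero (ω₂ lam β γ : ℝ) {w : PhaseSpace N → ℝ}
    (hw : ContDiff ℝ 2 w) (hHw : ∀ z, poisson ((pinnedChain ω₂ lam β γ).hamiltonian N) w z = 0) (k : Fin N)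
    (hp : ∀ z, partialP k w z = 0) (z : PhaseSpace N) : partialQ k w z = 0 := by
  set H := (pinnedChain ω₂ lam β γ).hamiltonian N with hH
  have hHs : ContDiff ℝ 2 H := pinnedChain_contDiff_hamiltonian ω₂ lam β γ N
  have hj := poisson_jacobi hw hHs (contDiff_position k (n := 2)) z
  -- `{H, q_k} = ∂_{p_k} H = p_k`
  have e1 : poisson H (fun z : PhaseSpace N => z.1 k) = fun z : PhaseSpace N => z.2 k := by
    funext y
    rw [poisson_position_right, hH, partialP_hamiltonian]
  -- `{q_k, w} = -∂_{p_k} w ≡ 0`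
  have e2 : ∀ y, poisson (fun z : PhaseSpace N => z.1 k) w y = 0 := fun y => by
    rw [poisson_antisymm, poisson_position_right, hp, neg_zero]
  -- `{w, H} ≡ 0`
  have e3 : ∀ y, poisson w H y = 0 := fun y => by rw [poisson_antisymm, hHw, neg_zero]
  rw [e1, poisson_momentum_right, poisson_eq_zero_of_right_eq_zero _ e2,
    poisson_eq_zero_of_right_eq_zero _ e3] at hj
  linarith

/-! ### The force `∂_{q_k} H` and its position derivatives -/

/-- `∂_{q_k} H` depends on the positions only, so `∂_{p_i} ∂_{q_k} H = 0`. [folklore] -/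
theorem partialP_partialQ_hamiltonian (P : OscillatorChain) (k i : Fin N) (z : PhaseSpace N) :
    partialP i (fun z : PhaseSpace N => partialQ k (P.hamiltonian N) z) z = 0 := by
  have : (fun z : PhaseSpace N => partialQ k (P.hamiltonian N) z) = fun z : PhaseSpace N =>
      (fun q : Fin N → ℝ => deriv (fun t => P.potential N (Function.update q k t)) (q k)) z.1 := by
    funext y
    rw [OscillatorChain.partialQ_hamiltonian_eq]
  rw [this]
  exact partialP_of_fst (fun q : Fin N → ℝ => deriv (fun t => P.potential N (Function.update q k t)) (q k)) i z

/-- Updating a far-away position does not change `leftTerm g · k`. [folklore] -/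
theorem leftTerm_update_of_ne (g : ℝ → ℝ) (q : Fin N → ℝ) (k x : Fin N) (t : ℝ) (hkx : k ≠ x)
    (hx : x.val + 1 ≠ k.val) : leftTerm g (Function.update q x t) k = leftTerm g q k := by
  unfold leftTerm
  split_ifs with h
  · have h1 : (⟨k.val - 1, by omega⟩ : Fin N) ≠ x := by
      intro e
      apply hx
      have := congrArg Fin.val e
      simp only at this
      omega
    rw [Function.update_of_ne hkx, Function.update_of_ne h1]
  · rfl

/-- Updating a far-away position does not change `rightTerm g · k`. [folklore] -/
theorem rightTerm_update_of_ne (g : ℝ → ℝ) (q : Fin N → ℝ) (k x : Fin N) (t : ℝ) (hkx : k ≠ x)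
    (hx : x.val ≠ k.val + 1) : rightTerm g (Function.update q x t) k = rightTerm g q k := by
  unfold rightTerm
  split_ifs with h
  · have h1 : (⟨k.val + 1, h⟩ : Fin N) ≠ x := by
      intro e
      apply hx
      have := congrArg Fin.val e
      simp only at this
      omega
    rw [Function.update_of_ne hkx, Function.update_of_ne h1]
  · rfl

/-- Updating the right neighbour: `rightTerm g (q[x ↦ t]) k = g (t - q_k)` for `x = k + 1`.
[folklore] -/
theorem rightTerm_update_succ (g : ℝ → ℝ) (q : Fin N → ℝ) (k x : Fin N) (t : ℝ)
    (hx : x.val = k.val + 1) : rightTerm g (Function.update q x t) k = g (t - q k) := by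
  unfold rightTerm
  have h : k.val + 1 < N := hx ▸ x.isLt
  rw [dif_pos h]
  have e : (⟨k.val + 1, h⟩ : Fin N) = x := Fin.ext hx.symm
  have hkx : k ≠ x := by
    intro e'
    have := congrArg Fin.val e'
    omega
  rw [e, Function.update_self, Function.update_of_ne hkx]

/-- **Locality of the force**: `∂_{q_x} ∂_{q_k} H = 0` unless `|x - k| ≤ 1` (nearest-neighbour
chain). [folklore] -/
theorem partialQ_force_far (ω₂ lam β γ : ℝ) (k x : Fin N) (hkx : x ≠ k) (hx1 : x.val + 1 ≠ k.val)
    (hx2 : x.val ≠ k.val + 1) (z : PhaseSpace N) :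
    partialQ x (fun z : PhaseSpace N => partialQ k ((pinnedChain ω₂ lam β γ).hamiltonian N) z) z = 0 := by
  set P := pinnedChain ω₂ lam β γ with hP
  have hU : Differentiable ℝ P.U := (pinnedChain_contDiff_U ω₂ lam β γ (n := 1)).differentiable one_ne_zero
  have hV : Differentiable ℝ P.V := (pinnedChain_contDiff_V ω₂ lam β γ (n := 1)).differentiable one_ne_zero
  show deriv (fun t => partialQ k (P.hamiltonian N) (Function.update z.1 x t, z.2)) (z.1 x) = 0
  have hc : (fun t => partialQ k (P.hamiltonian N) (Function.update z.1 x t, z.2)) =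
      fun _ => partialQ k (P.hamiltonian N) z := by
    funext t
    rw [Literature.Barriers.AtomisticToContinuum.partialQ_hamiltonian P hU hV,
      Literature.Barriers.AtomisticToContinuum.partialQ_hamiltonian P hU hV]
    simp only
    rw [Function.update_of_ne (Ne.symm hkx), leftTerm_update_of_ne _ _ _ _ _ (Ne.symm hkx) hx1,
      rightTerm_update_of_ne _ _ _ _ _ (Ne.symm hkx) hx2]
  rw [hc, deriv_const]

/-- **The one non-trivial coupling**: `∂_{q_{k+1}} ∂_{q_k} H = -V''(q_{k+1} - q_k)`, with
`V'' = 1 + 3βr²` for the pinned chain. [folklore] -/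
theorem partialQ_force_succ (ω₂ lam β γ : ℝ) (k x : Fin N) (hx : x.val = k.val + 1)
    (z : PhaseSpace N) :
    partialQ x (fun z : PhaseSpace N => partialQ k ((pinnedChain ω₂ lam β γ).hamiltonian N) z) z =
      -(1 + 3 * β * (z.1 x - z.1 k) ^ 2) := by
  set P := pinnedChain ω₂ lam β γ with hP
  have hU : Differentiable ℝ P.U := (pinnedChain_contDiff_U ω₂ lam β γ (n := 1)).differentiable one_ne_zero
  have hV : Differentiable ℝ P.V := (pinnedChain_contDiff_V ω₂ lam β γ (n := 1)).differentiable one_ne_zero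
  have hkx : k ≠ x := by
    intro e
    have := congrArg Fin.val e
    omega
  have hx1 : x.val + 1 ≠ k.val := by omega
  show deriv (fun t => partialQ k (P.hamiltonian N) (Function.update z.1 x t, z.2)) (z.1 x) = _
  have hc : (fun t => partialQ k (P.hamiltonian N) (Function.update z.1 x t, z.2)) =
      fun t => deriv P.U (z.1 k) + leftTerm (deriv P.V) z.1 k - deriv P.V (t - z.1 k) := by
    funext t
    rw [Literature.Barriers.AtomisticToContinuum.partialQ_hamiltonian P hU hV]
    simp only
    rw [Function.update_of_ne hkx, leftTerm_update_of_ne _ _ _ _ _ hkx hx1,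
      rightTerm_update_succ _ _ _ _ _ hx]
  rw [hc]
  have hV' : deriv P.V = fun r => r + β * r ^ 3 := funext (pinnedChain_deriv_V ω₂ lam β γ)
  have hdV : ∀ r, HasDerivAt (deriv P.V) (1 + 3 * β * r ^ 2) r := fun r => by
    rw [hV']
    refine ((hasDerivAt_id' r).add ((hasDerivAt_pow 3 r).const_mul β)).congr_deriv ?_
    push_cast
    norm_num
    ring
  have h1 : HasDerivAt (fun t : ℝ => t - z.1 k) 1 (z.1 x) := (hasDerivAt_id' _).sub_const _
  have h2 : HasDerivAt (fun t => deriv P.V (t - z.1 k)) ((1 + 3 * β * (z.1 x - z.1 k) ^ 2) * 1)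
      (z.1 x) := by
    have := HasDerivAt.comp (z.1 x) (hdV (z.1 x - z.1 k)) h1
    exact this
  have hd : HasDerivAt (fun t => deriv P.U (z.1 k) + leftTerm (deriv P.V) z.1 k - deriv P.V (t - z.1 k))
      (0 - (1 + 3 * β * (z.1 x - z.1 k) ^ 2) * 1) (z.1 x) :=
    (hasDerivAt_const _ _).sub h2
  rw [hd.deriv]
  ring

/-- **Recursion A**: for `w ∈ C²` with `{H, w} ≡ 0`, if `∂_{q_k} w ≡ 0` and `∂_{p_j} w ≡ 0` for all
`j ≤ k`, then `∂_{p_{k+1}} w ≡ 0` (Jacobi with the coordinate `p_k`: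
`{w, {H, p_k}} = -{w, ∂_{q_k}H} = V''(q_{k+1} - q_k) ∂_{p_{k+1}} w`, and `V'' > 0`). [folklore] -/
theorem partialP_succ_eq_zero (ω₂ lam : ℝ) (hβ : 0 ≤ β) (γ : ℝ) {w : PhaseSpace N → ℝ}
    (hw : ContDiff ℝ 2 w) (hHw : ∀ z, poisson ((pinnedChain ω₂ lam β γ).hamiltonian N) w z = 0) (k x : Fin N)
    (hx : x.val = k.val + 1) (hq : ∀ z, partialQ k w z = 0)
    (hp : ∀ j : Fin N, j.val ≤ k.val → ∀ z, partialP j w z = 0) (z : PhaseSpace N) :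
    partialP x w z = 0 := by
  set H := (pinnedChain ω₂ lam β γ).hamiltonian N with hH
  have hHs : ContDiff ℝ 2 H := pinnedChain_contDiff_hamiltonian ω₂ lam β γ N
  have hj := poisson_jacobi hw hHs (contDiff_momentum k (n := 2)) z
  set G : PhaseSpace N → ℝ := fun y => partialQ k H y with hG
  -- `{H, p_k} = -∂_{q_k} H`
  have e1 : poisson H (fun z : PhaseSpace N => z.2 k) = fun y => -G y := by
    funext y
    rw [poisson_momentum_right]
  -- `{p_k, w} = ∂_{q_k} w ≡ 0`
  have e2 : ∀ y, poisson (fun z : PhaseSpace N => z.2 k) w y = 0 := fun y => by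
    rw [poisson_antisymm, poisson_momentum_right, hq, neg_zero, neg_zero]
  have e3 : ∀ y, poisson w H y = 0 := fun y => by rw [poisson_antisymm, hHw, neg_zero]
  rw [e1, poisson_neg_right, poisson_eq_zero_of_right_eq_zero _ e2,
    poisson_eq_zero_of_right_eq_zero _ e3, add_zero, add_zero, neg_eq_zero] at hj
  -- expand `{w, G} = Σ_i ∂_{p_i} w ∂_{q_i} G` and isolate `i = x`
  have hkx : k ≠ x := by
    intro e
    have := congrArg Fin.val e
    omega
  unfold poisson at hj
  rw [Finset.sum_eq_single x] at hj
  · rw [hG, partialP_partialQ_hamiltonian, mul_zero, sub_zero, partialQ_force_succ ω₂ lam β γ k x hx]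
      at hj
    have hV2 : (1 + 3 * β * (z.1 x - z.1 k) ^ 2) ≠ 0 := by positivity
    have : partialP x w z * (1 + 3 * β * (z.1 x - z.1 k) ^ 2) = 0 := by linarith
    exact (mul_eq_zero.1 this).resolve_right hV2
  · intro i _ hix
    rw [hG, partialP_partialQ_hamiltonian, mul_zero, sub_zero]
    by_cases hik : i.val ≤ k.val
    · rw [hp i hik, zero_mul]
    · have h1 : i ≠ k := by
        intro e
        exact hik (le_of_eq (congrArg Fin.val e))
      have h2 : i.val + 1 ≠ k.val := by omega
      have h3 : i.val ≠ k.val + 1 := by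
        intro e
        exact hix (Fin.ext (by omega))
      rw [partialQ_force_far ω₂ lam β γ k i h1 h2 h3, mul_zero]
  · intro h
    exact absurd (Finset.mem_univ x) h

/-- **First-integral rigidity of the closed pinned chain.** For `β ≥ 0` (so `V'' = 1 + 3βr² > 0`),
every `N`, and every `w ∈ C²(ℝ^N × ℝ^N)` with `{H, w} ≡ 0` (a first integral of the isolated chain)
and `∂_{p_0} w ≡ 0` (blind to the left contact momentum), ALL coordinate derivatives of `w`
vanish: the Jacobi recursions A and B sweep the chain from the left end. [folklore] -/
theorem poisson_hamiltonian_rigidity (ω₂ lam : ℝ) (hβ : 0 ≤ β) (γ : ℝ) {w : PhaseSpace N → ℝ}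
    (hw : ContDiff ℝ 2 w) (hHw : ∀ z, poisson ((pinnedChain ω₂ lam β γ).hamiltonian N) w z = 0)
    (h0 : ∀ i : Fin N, i.val = 0 → ∀ z, partialP i w z = 0) (i : Fin N) (z : PhaseSpace N) :
    partialP i w z = 0 ∧ partialQ i w z = 0 := by
  suffices key : ∀ n : ℕ, ∀ i : Fin N, i.val < n →
      (∀ z, partialP i w z = 0) ∧ (∀ z, partialQ i w z = 0) by
    exact ⟨(key (i.val + 1) i (Nat.lt_succ_self _)).1 z, (key (i.val + 1) i (Nat.lt_succ_self _)).2 z⟩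
  intro n
  induction n with
  | zero => intro i hi; exact absurd hi (Nat.not_lt_zero _)
  | succ n ih =>
    intro i hi
    by_cases hlt : i.val < n
    · exact ih i hlt
    have heq : i.val = n := by omega
    have hP : ∀ z, partialP i w z = 0 := by
      rcases Nat.eq_zero_or_eq_succ_pred n with h | h
      · exact h0 i (heq.trans h)
      · have hm : n - 1 < N := by omega
        set k : Fin N := ⟨n - 1, hm⟩ with hk
        have hx : i.val = k.val + 1 := by rw [hk]; simp only; omega
        refine partialP_succ_eq_zero ω₂ lam hβ γ hw hHw k i hx (ih k (by simp [hk]; omega)).2 ?_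
        intro j hj
        exact (ih j (by simp [hk] at hj; omega)).1
    exact ⟨hP, fun z => partialQ_eq_zero_of_partialP_eq_zero ω₂ lam β γ hw hHw i hP z⟩

end Rigidity

/-! ### Constancy form of the rigidity lemma -/

/-- A differentiable function on phase space all of whose coordinate derivatives vanish is constant.
[folklore] -/
theorem eq_of_partial_eq_zero {w : PhaseSpace N → ℝ} (hw : Differentiable ℝ w)
    (h : ∀ (i : Fin N) (z : PhaseSpace N), partialP i w z = 0 ∧ partialQ i w z = 0)
    (x y : PhaseSpace N) : w x = w y := by
  refine is_const_of_fderiv_eq_zero hw (fun z => ?_) x y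
  have hQ : ∀ i, fderiv ℝ w z ((Pi.single i 1, 0) : PhaseSpace N) = 0 := fun i => by
    have := (h i z).2
    rwa [partialQ_eq_fderiv hw] at this
  have hP : ∀ i, fderiv ℝ w z ((0, Pi.single i 1) : PhaseSpace N) = 0 := fun i => by
    have := (h i z).1
    rwa [partialP_eq_fderiv hw] at this
  refine ContinuousLinearMap.ext fun v => ?_
  have hv : v = (∑ i : Fin N, v.1 i • ((Pi.single i 1, 0) : PhaseSpace N)) +
      ∑ i : Fin N, v.2 i • ((0, Pi.single i 1) : PhaseSpace N) := by
    refine Prod.ext ?_ ?_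
    · simp only [Prod.fst_add, Prod.fst_sum, Prod.smul_fst, smul_zero, Finset.sum_const_zero,
        add_zero]
      rw [← Finset.univ_sum_single v.1]
      refine Finset.sum_congr rfl fun i _ => ?_
      ext j
      by_cases hj : j = i
      · subst hj; simp
      · simp [hj]
    · simp only [Prod.snd_add, Prod.snd_sum, Prod.smul_snd, smul_zero, Finset.sum_const_zero,
        zero_add]
      rw [← Finset.univ_sum_single v.2]
      refine Finset.sum_congr rfl fun i _ => ?_
      ext j
      by_cases hj : j = i
      · subst hj; simp
      · simp [hj]
  rw [hv, map_add, map_sum, map_sum]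
  simp only [map_smul, hQ, hP, smul_zero, Finset.sum_const_zero, add_zero,
    zero_apply]

/-- **Rigidity, constancy form**: a `C²` first integral of the closed pinned chain (`β ≥ 0`) that
does not depend on the left contact momentum `p_0` is constant. [folklore] -/
theorem poisson_hamiltonian_rigidity_const (ω₂ lam : ℝ) {β : ℝ} (hβ : 0 ≤ β) (γ : ℝ)
    {w : PhaseSpace N → ℝ} (hw : ContDiff ℝ 2 w)
    (hHw : ∀ z, poisson ((pinnedChain ω₂ lam β γ).hamiltonian N) w z = 0)
    (h0 : ∀ i : Fin N, i.val = 0 → ∀ z, partialP i w z = 0) (x y : PhaseSpace N) : w x = w y :=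
  eq_of_partial_eq_zero (hw.differentiable (by norm_num))
    (poisson_hamiltonian_rigidity ω₂ lam hβ γ hw hHw h0) x y

/-- **Registered form** (sub-goal `firstIntegral_rigidity` of stub `stub_positiveConductance`): a `C²`
first integral of the closed pinned chain (`β ≥ 0`) that is blind to the left contact momentum `p_0` is
constant. [folklore] -/
theorem firstIntegral_rigidity :
    ∀ (ω₂ lam β γ : ℝ), 0 ≤ β → ∀ (N : ℕ) (w : PhaseSpace N → ℝ), ContDiff ℝ 2 w →
      (∀ z, poisson ((pinnedChain ω₂ lam β γ).hamiltonian N) w z = 0) →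
      (∀ i : Fin N, i.val = 0 → ∀ z, partialP i w z = 0) → ∀ x y : PhaseSpace N, w x = w y :=
  fun ω₂ lam _β γ hβ _N _w hw hHw h0 x y => poisson_hamiltonian_rigidity_const ω₂ lam hβ γ hw hHw h0 x y
end Summit.AtomisticToContinuum.FouriersLaw.Cruxes.BoundedResponseConverges.TwoScaleGluingLogRigidity.Stubs

end
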